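import Summits.ValiantsHypothesis.ValiantsHypothesis.Theorems.KPlusLogSqLawTropicalBComparabilityLinear

/-!
# `TropicalB` (stmt-ValiantsHypothesis-19771) — PURE THREE-REGISTER CHAINS, part 1a: exchange lemmas and the count of
# (second, third)-configurations occurring right of a cut (`≤ (3(N₂+N₃)+1)·L`)

Helper file for the crux `Theses.KPlusLogSqLaw.TropicalB` (`--supports stmt-ValiantsHypothesis-19771 --as helper`), cell
`pub-symmetroid`, seat val-sym-trop-p2 (g7).  HONEST FRAMING: a structure theorem about a SUB-FAMILY of the terms of an ARBITRARY
design, in the tree's vocabulary (`IsDominant`, `tropWeight`, `termSign`), in the style and with the tools of the LINEAR COMPARABILITY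
LAW (`ComparabilityLinear.card_dominant_le_linear`, val-sym-trop-p5 g5, p487811; abstract core `card_le_of_adjacent_records`,
p487275).  The family is a PURE CHAIN of three registers — the `r = 3` case of the grid families of Gajjar–Radhakrishnan
(«Parametric shortest paths in planar graphs», 2018/2019, App. B: `Υ_{4,q}` has `O(q log q)` break points, Thm 53) — and it
lives inside the Hessenberg sector, where `TropicalB` holds (`tropicalB_hessenberg`); nothing here bears on `TropicalB` in its
window, on `WeakLifting`, on `MatrixDescartes` (stmt-ValiantsHypothesis-18050) or on VP ≠ VNP.

## The family
Inside a design `(d, v, ε)` of format `(m, K)` take terms `τ j y k z u w` (`j < N₁`, `k < N₂`, `u < N₃`; positions `y, z, w < L`)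
which, whenever `y < z < w`, are present, pairwise distinct, and have weights
`tropWeight d v θ (τ j y k z u w) = θ·(s₁ j y + s₂ k z + s₃ u w) − (A₁ j y + A₂ k z + A₃ u w)` for ARBITRARY integer tables:
three registers on a common window of `L` positions, slopes and valuations adding, coupled ONLY through `y < z < w`.

## Statement (this file: `card_configs_le`; part 1b `…TropicalBPureChainCut`: the CUT LAW `card_straddle_le`)
For every cut `c`, the members with `y < c ≤ z` (the first register left of the cut, the other two right of it) that are dominant
(each at some integer slope, against all present terms) number at most `N₁·c + (3(N₂+N₃)+1)·L`; this file proves the exchange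
lemmas of the family and the bound `(3(N₂+N₃)+1)·L` on the number of (second, third)-configurations `(k,z,u,w)` occurring in such
members.  (Part 2 will mirror the cut law for the cut between the second and the third register and sum over a dyadic family of
cuts: `O((N₁+N₂+N₃+1)·L·log L)` dominant members in all — Thm 53 of Gajjar–Radhakrishnan for `p = 4` rows, with multiplicities.)

## Proof
A straddling member is a pair (first-register state `x = (j,y)` with `y < c`, two-register configuration `ω = (k,z,u,w)` with
`c ≤ z < w`), and ANY such pair is feasible.  Hence (full exchangeability across the cut) along the dominant straddling members
sorted by slope both the `x`-slope and the `ω`-slope are non-decreasing and strictly increase whenever `x` resp. `ω` changes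
(`xc_lt_of_dominant`, `cfg_lt_of_dominant`): the members form a monotone staircase in (distinct `x` used) × (distinct `ω` used), so
`#members ≤ #x + #ω − 1` (`card_le_of_ranks`).  `#x ≤ N₁·c`.  For `#ω` (`card_configs_le`): pick one dominant member through
each occurring `ω`; relative to the window `[c, L)` its `z` is a strict PREFIX RECORD of the second register and its `w` a strict
SUFFIX RECORD of the third, with no record strictly between — the competitors used are feasible because `y < c` — and the record
predicates are interval-shaped in the slope, so the abstract count `card_le_of_adjacent_records` gives `#ω ≤ (3(N₂+N₃)+1)·L`.
[folklore-level; the counting core is p487275; the grid bound is Gajjar–Radhakrishnan 2018, App. B]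
-/

set_option linter.dupNamespace false
set_option autoImplicit false

namespace Summit.ValiantsHypothesis.ValiantsHypothesis.Theorems.KPlusLogSqLaw.PureChain

open Summit.ValiantsHypothesis.ValiantsHypothesis.Theorems.MatrixDescartes.Negative
open Summit.ValiantsHypothesis.ValiantsHypothesis.Theorems.KPlusLogSqLaw.ComparabilityLinear
  (card_le_of_adjacent_records card_flips_exists_le)
open Finset

/-- A finite set carrying two `ℕ`-valued ranks `f < F`, `g < G` such that any two distinct members are comparable in the
product order with at least one strict coordinate has at most `F + G − 1` members (the sum `f + g` is injective into
`range (F + G − 1)`). [folklore] -/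
theorem card_le_of_ranks {α : Type*} (s : Finset α) (f g : α → ℕ) (F G : ℕ)
    (hf : ∀ a ∈ s, f a < F) (hg : ∀ a ∈ s, g a < G)
    (hch : ∀ a ∈ s, ∀ b ∈ s, a ≠ b →
      (f a ≤ f b ∧ g a ≤ g b ∧ (f a < f b ∨ g a < g b)) ∨
      (f b ≤ f a ∧ g b ≤ g a ∧ (f b < f a ∨ g b < g a))) :
    s.card ≤ F + G - 1 := by
  classical
  have hmaps : ∀ a ∈ s, f a + g a ∈ Finset.range (F + G - 1) := by
    intro a ha
    have h1 := hf a ha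
    have h2 := hg a ha
    simp only [Finset.mem_range]
    omega
  have hinj : Set.InjOn (fun a => f a + g a) s := by
    intro a ha b hb hab
    by_contra hne
    simp only at hab
    rcases hch a (Finset.mem_coe.1 ha) b (Finset.mem_coe.1 hb) hne with ⟨h5, h6, h7⟩ | ⟨h5, h6, h7⟩ <;>
      rcases h7 with h7 | h7 <;> omega
  calc s.card ≤ (Finset.range (F + G - 1)).card := Finset.card_le_card_of_injOn _ hmaps hinj
    _ = _ := Finset.card_range _

section Family

variable {m K N₁ N₂ N₃ L : ℕ}
  (d : Fin K → ℕ) (v ε : Fin m → Fin m → Fin K → ℤ)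
  (τ : Fin N₁ → Fin L → Fin N₂ → Fin L → Fin N₃ → Fin L → Equiv.Perm (Fin m) × (Fin m → Fin K))
  (s₁ : Fin N₁ → Fin L → ℤ) (s₂ : Fin N₂ → Fin L → ℤ) (s₃ : Fin N₃ → Fin L → ℤ)
  (A₁ : Fin N₁ → Fin L → ℤ) (A₂ : Fin N₂ → Fin L → ℤ) (A₃ : Fin N₃ → Fin L → ℤ)
  (hinj : ∀ j y k z u w j' y' k' z' u' w', y < z → z < w → y' < z' → z' < w' →
    τ j y k z u w = τ j' y' k' z' u' w' → j = j' ∧ y = y' ∧ k = k' ∧ z = z' ∧ u = u' ∧ w = w')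
  (hpres : ∀ j y k z u w, y < z → z < w → termSign ε (τ j y k z u w) ≠ 0)
  (hw : ∀ j y k z u w (θ : ℤ), y < z → z < w →
    tropWeight d v θ (τ j y k z u w) = θ * (s₁ j y + s₂ k z + s₃ u w) - (A₁ j y + A₂ k z + A₃ u w))

include hinj hpres hw in
/-- the basic comparison: a dominant member beats every other feasible member of the family (explicit weights). -/
theorem weight_lt {j j' : Fin N₁} {y y' z z' w w' : Fin L} {k k' : Fin N₂} {u u' : Fin N₃} {θ : ℤ}
    (hyz : y < z) (hzw : z < w) (hyz' : y' < z') (hzw' : z' < w')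
    (hdom : IsDominant d v ε θ (τ j y k z u w))
    (hne : ¬ (j = j' ∧ y = y' ∧ k = k' ∧ z = z' ∧ u = u' ∧ w = w')) :
    θ * (s₁ j' y' + s₂ k' z' + s₃ u' w') - (A₁ j' y' + A₂ k' z' + A₃ u' w') <
      θ * (s₁ j y + s₂ k z + s₃ u w) - (A₁ j y + A₂ k z + A₃ u w) := by
  have h := hdom.2 (τ j' y' k' z' u' w') ?_ (hpres j' y' k' z' u' w' hyz' hzw')
  · rwa [hw j' y' k' z' u' w' θ hyz' hzw', hw j y k z u w θ hyz hzw] at h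
  · intro h
    obtain ⟨h1, h2, h3, h4, h5, h6⟩ := hinj _ _ _ _ _ _ _ _ _ _ _ _ hyz' hzw' hyz hzw h
    exact hne ⟨h1.symm, h2.symm, h3.symm, h4.symm, h5.symm, h6.symm⟩

include hinj hpres hw in
/-- two family members dominant at the SAME slope coincide. -/
theorem eq_of_theta_eq {j j' : Fin N₁} {y y' z z' w w' : Fin L} {k k' : Fin N₂} {u u' : Fin N₃} {θ : ℤ}
    (hyz : y < z) (hzw : z < w) (hyz' : y' < z') (hzw' : z' < w')
    (h1 : IsDominant d v ε θ (τ j y k z u w)) (h2 : IsDominant d v ε θ (τ j' y' k' z' u' w')) :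
    j = j' ∧ y = y' ∧ k = k' ∧ z = z' ∧ u = u' ∧ w = w' := by
  by_contra hne
  have hne' : ¬ (j' = j ∧ y' = y ∧ k' = k ∧ z' = z ∧ u' = u ∧ w' = w) := by
    rintro ⟨e1, e2, e3, e4, e5, e6⟩; exact hne ⟨e1.symm, e2.symm, e3.symm, e4.symm, e5.symm, e6.symm⟩
  have e1 := weight_lt d v ε τ s₁ s₂ s₃ A₁ A₂ A₃ hinj hpres hw hyz hzw hyz' hzw' h1 hne
  have e2 := weight_lt d v ε τ s₁ s₂ s₃ A₁ A₂ A₃ hinj hpres hw hyz' hzw' hyz hzw h2 hne'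
  linarith

include hinj hpres hw in
/-- FIRST-register exchange: a dominant member beats the state `(j', y')` of every position `y' < z`. -/
theorem x_lt_of_dominant {j j' : Fin N₁} {y y' z w : Fin L} {k : Fin N₂} {u : Fin N₃} {θ : ℤ}
    (hyz : y < z) (hzw : z < w) (hy'z : y' < z) (hdom : IsDominant d v ε θ (τ j y k z u w))
    (hne : ¬ (j = j' ∧ y = y')) :
    θ * s₁ j' y' - A₁ j' y' < θ * s₁ j y - A₁ j y := by
  have h := weight_lt d v ε τ s₁ s₂ s₃ A₁ A₂ A₃ hinj hpres hw hyz hzw hy'z hzw hdom (j' := j') (k' := k) (u' := u)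
    (by rintro ⟨a, b, -, -, -, -⟩; exact hne ⟨a, b⟩)
  linarith

include hinj hpres hw in
/-- SECOND-register exchange: a dominant member beats the state `(k', z')` of every position `z'` with `y < z' < w`. -/
theorem k_lt_of_dominant {j : Fin N₁} {y z z' w : Fin L} {k k' : Fin N₂} {u : Fin N₃} {θ : ℤ}
    (hyz : y < z) (hzw : z < w) (hyz' : y < z') (hz'w : z' < w) (hdom : IsDominant d v ε θ (τ j y k z u w))
    (hne : ¬ (k = k' ∧ z = z')) :
    θ * s₂ k' z' - A₂ k' z' < θ * s₂ k z - A₂ k z := by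
  have h := weight_lt d v ε τ s₁ s₂ s₃ A₁ A₂ A₃ hinj hpres hw hyz hzw hyz' hz'w hdom (j' := j) (k' := k') (u' := u)
    (by rintro ⟨-, -, a, b, -, -⟩; exact hne ⟨a, b⟩)
  linarith

include hinj hpres hw in
/-- THIRD-register exchange: a dominant member beats the state `(u', w')` of every position `w' > z`. -/
theorem u_lt_of_dominant {j : Fin N₁} {y z w w' : Fin L} {k : Fin N₂} {u u' : Fin N₃} {θ : ℤ}
    (hyz : y < z) (hzw : z < w) (hzw' : z < w') (hdom : IsDominant d v ε θ (τ j y k z u w))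
    (hne : ¬ (u = u' ∧ w = w')) :
    θ * s₃ u' w' - A₃ u' w' < θ * s₃ u w - A₃ u w := by
  have h := weight_lt d v ε τ s₁ s₂ s₃ A₁ A₂ A₃ hinj hpres hw hyz hzw hyz hzw' hdom (j' := j) (k' := k) (u' := u')
    (by rintro ⟨-, -, -, -, a, b⟩; exact hne ⟨a, b⟩)
  linarith

include hinj hpres hw in
/-- CROSS exchange of the whole (second, third)-configuration across a cut `c`: if `(j,y,k,z,u,w)` is dominant at `θ` with
`y < c`, then its configuration `(k,z,u,w)` beats every configuration `(k',z',u',w')` with `c ≤ z' < w'` at `θ`. -/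
theorem cfg_lt_of_dominant {j : Fin N₁} {y z z' w w' : Fin L} {k k' : Fin N₂} {u u' : Fin N₃} {θ : ℤ} {c : ℕ}
    (hyz : y < z) (hzw : z < w) (hyc : (y : ℕ) < c) (hcz' : c ≤ (z' : ℕ)) (hz'w' : z' < w')
    (hdom : IsDominant d v ε θ (τ j y k z u w)) (hne : ¬ (k = k' ∧ z = z' ∧ u = u' ∧ w = w')) :
    θ * (s₂ k' z' + s₃ u' w') - (A₂ k' z' + A₃ u' w') < θ * (s₂ k z + s₃ u w) - (A₂ k z + A₃ u w) := by
  have hyz' : y < z' := Fin.lt_def.2 (by omega)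
  have h := weight_lt d v ε τ s₁ s₂ s₃ A₁ A₂ A₃ hinj hpres hw hyz hzw hyz' hz'w' hdom (j' := j) (k' := k') (u' := u')
    (by rintro ⟨-, -, a, b, e, f⟩; exact hne ⟨a, b, e, f⟩)
  linarith

include hinj hpres hw in
/-- CROSS exchange of the first-register state across a cut `c`: if `(j,y,k,z,u,w)` is dominant at `θ` with `c ≤ z`, then its
state `(j,y)` beats every state `(j',y')` with `y' < c` at `θ`. -/
theorem xc_lt_of_dominant {j j' : Fin N₁} {y y' z w : Fin L} {k : Fin N₂} {u : Fin N₃} {θ : ℤ} {c : ℕ}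
    (hyz : y < z) (hzw : z < w) (hy'c : (y' : ℕ) < c) (hcz : c ≤ (z : ℕ))
    (hdom : IsDominant d v ε θ (τ j y k z u w)) (hne : ¬ (j = j' ∧ y = y')) :
    θ * s₁ j' y' - A₁ j' y' < θ * s₁ j y - A₁ j y :=
  x_lt_of_dominant d v ε τ s₁ s₂ s₃ A₁ A₂ A₃ hinj hpres hw hyz hzw (Fin.lt_def.2 (by omega)) hdom hne

open scoped Classical in
include hinj hpres hw in
/-- **Occurring (second, third)-configurations right of a cut are few.**  The configurations `(k,z,u,w)` (`c ≤ z < w`) that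
occur in SOME dominant member whose first register sits left of the cut `c` number at most `(3(N₂+N₃)+1)·L`: one dominant
member through each of them gives a sequence with adjacent record pairs relative to the window `[c, L)` (kinetic record
argument of `ComparabilityLinear.card_dominant_le_linear`, abstract count `card_le_of_adjacent_records`). -/
theorem card_configs_le (c : ℕ) (S : Finset ((Fin N₁ × Fin L × Fin N₂ × Fin L × Fin N₃ × Fin L)))
    (hS : ∀ i ∈ S, i.2.1 < i.2.2.2.1 ∧ i.2.2.2.1 < i.2.2.2.2.2 ∧ (i.2.1 : ℕ) < c ∧ c ≤ (i.2.2.2.1 : ℕ) ∧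
      ∃ θ : ℤ, IsDominant d v ε θ (τ i.1 i.2.1 i.2.2.1 i.2.2.2.1 i.2.2.2.2.1 i.2.2.2.2.2)) :
    (S.image fun i => (i.2.2.1, i.2.2.2.1, i.2.2.2.2.1, i.2.2.2.2.2)).card ≤ (3 * (N₂ + N₃) + 1) * L := by
  classical
  set W := S.image fun i => (i.2.2.1, i.2.2.2.1, i.2.2.2.2.1, i.2.2.2.2.2) with hW
  rcases Nat.eq_zero_or_pos W.card with h0 | hpos
  · rw [h0]; exact Nat.zero_le _
  obtain ⟨ω₀, hω₀⟩ := Finset.card_pos.1 hpos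
  -- a dominant member through each occurring configuration, and its slope
  have hpre : ∀ ω ∈ W, ∃ i ∈ S, (i.2.2.1, i.2.2.2.1, i.2.2.2.2.1, i.2.2.2.2.2) = ω := fun ω hω => by
    simpa only [W, Finset.mem_image] using hω
  obtain ⟨i₀, -, -⟩ := hpre ω₀ hω₀
  haveI : Nonempty ((Fin N₁ × Fin L × Fin N₂ × Fin L × Fin N₃ × Fin L)) := ⟨i₀⟩
  choose! rep hrepS hrepω using hpre
  have hex : ∀ i ∈ S, ∃ θ : ℤ, IsDominant d v ε θ (τ i.1 i.2.1 i.2.2.1 i.2.2.2.1 i.2.2.2.2.1 i.2.2.2.2.2) :=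
    fun i hi => (hS i hi).2.2.2.2
  choose! Θ hΘ using hex
  -- members through distinct configurations are distinct, hence dominant at distinct slopes
  have hTinj : Set.InjOn (fun ω => Θ (rep ω)) ↑W := by
    intro ω hω ω' hω' he
    have hω₁ := Finset.mem_coe.1 hω
    have hω₂ := Finset.mem_coe.1 hω'
    have hi := hrepS ω hω₁
    have hi' := hrepS ω' hω₂
    have h1 := hΘ _ hi
    have h2 := hΘ _ hi'
    simp only at he
    rw [he] at h1
    obtain ⟨-, -, e3, e4, e5, e6⟩ := eq_of_theta_eq d v ε τ s₁ s₂ s₃ A₁ A₂ A₃ hinj hpres hw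
      (hS _ hi).1 (hS _ hi).2.1 (hS _ hi').1 (hS _ hi').2.1 h1 h2
    rw [← hrepω ω hω₁, ← hrepω ω' hω₂, e3, e4, e5, e6]
  -- enumerate the configurations by increasing slope of their representative
  set n := W.card with hn
  have hT : (W.image fun ω => Θ (rep ω)).card = n := Finset.card_image_of_injOn hTinj
  let e : Fin n ↪o ℤ := (W.image fun ω => Θ (rep ω)).orderEmbOfFin hT
  have hmemT : ∀ q : Fin n, ∃ ω ∈ W, Θ (rep ω) = e q := fun q => by
    have h := Finset.orderEmbOfFin_mem (W.image fun ω => Θ (rep ω)) hT q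
    simpa only [Finset.mem_image] using h
  choose conf hconf hΘconf using hmemT
  let conf' : ℕ → Fin N₂ × Fin L × Fin N₃ × Fin L := fun q => if h : q < n then conf ⟨q, h⟩ else ω₀
  have hconf'W : ∀ q, q < n → conf' q ∈ W := by
    intro q hq; simp only [conf', dif_pos hq]; exact hconf _
  have hconf'Θ : ∀ q (hq : q < n), Θ (rep (conf' q)) = e ⟨q, hq⟩ := by
    intro q hq; simp only [conf', dif_pos hq]; exact hΘconf _
  let t : ℕ → ℤ := fun q => Θ (rep (conf' q))
  have ht : ∀ q q', q < q' → q' < n → t q < t q' := by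
    intro q q' hqq' hq'
    show Θ (rep (conf' q)) < Θ (rep (conf' q'))
    rw [hconf'Θ q (hqq'.trans hq'), hconf'Θ q' hq']
    exact e.strictMono (Fin.mk_lt_mk.2 hqq')
  have hconf'inj : ∀ q q', q < n → q' < n → conf' q = conf' q' → q = q' := by
    intro q q' hq hq' heq
    have h1 : e ⟨q, hq⟩ = e ⟨q', hq'⟩ := by rw [← hconf'Θ q hq, ← hconf'Θ q' hq', heq]
    have h2 := e.injective h1
    simpa using h2
  -- the member data along the enumeration: `(jj, yy)` the first register of the representative, `(kk,zz,uu,ww)` the configuration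
  let mem : ℕ → (Fin N₁ × Fin L × Fin N₂ × Fin L × Fin N₃ × Fin L) := fun q => rep (conf' q)
  have hmemS : ∀ q, q < n → mem q ∈ S := fun q hq => hrepS _ (hconf'W q hq)
  have hmemω : ∀ q, q < n → ((mem q).2.2.1, (mem q).2.2.2.1, (mem q).2.2.2.2.1, (mem q).2.2.2.2.2) = conf' q :=
    fun q hq => hrepω _ (hconf'W q hq)
  let jj : ℕ → Fin N₁ := fun q => (mem q).1
  let yy : ℕ → Fin L := fun q => (mem q).2.1
  let kk : ℕ → Fin N₂ := fun q => (mem q).2.2.1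
  let zz : ℕ → Fin L := fun q => (mem q).2.2.2.1
  let uu : ℕ → Fin N₃ := fun q => (mem q).2.2.2.2.1
  let ww : ℕ → Fin L := fun q => (mem q).2.2.2.2.2
  have hyz : ∀ q, q < n → yy q < zz q := fun q hq => (hS _ (hmemS q hq)).1
  have hzw : ∀ q, q < n → zz q < ww q := fun q hq => (hS _ (hmemS q hq)).2.1
  have hyc : ∀ q, q < n → (yy q : ℕ) < c := fun q hq => (hS _ (hmemS q hq)).2.2.1
  have hcz : ∀ q, q < n → c ≤ (zz q : ℕ) := fun q hq => (hS _ (hmemS q hq)).2.2.2.1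
  have hdom : ∀ q, q < n → IsDominant d v ε (t q) (τ (jj q) (yy q) (kk q) (zz q) (uu q) (ww q)) :=
    fun q hq => hΘ _ (hmemS q hq)
  -- the record predicates RELATIVE TO THE WINDOW `[c, L)` and the record configurations
  let RA : Fin L → Fin N₂ → ℕ → Prop := fun x k₀ q => c ≤ (x : ℕ) ∧
    ∀ (k' : Fin N₂) (z' : Fin L), c ≤ (z' : ℕ) → z' < x → t q * s₂ k' z' - A₂ k' z' < t q * s₂ k₀ x - A₂ k₀ x
  let RB : Fin L → Fin N₃ → ℕ → Prop := fun x u₀ q =>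
    ∀ (u' : Fin N₃) (w' : Fin L), x < w' → t q * s₃ u' w' - A₃ u' w' < t q * s₃ u₀ x - A₃ u₀ x
  let Ar : ℕ → Finset (Fin L) := fun q => (Finset.univ : Finset (Fin L)).filter (fun x => ∃ k₀, RA x k₀ q)
  let Br : ℕ → Finset (Fin L) := fun q => (Finset.univ : Finset (Fin L)).filter (fun x => ∃ u₀, RB x u₀ q)
  have hmemAr : ∀ q x, x ∈ Ar q ↔ ∃ k₀, RA x k₀ q := fun q x => by
    simp only [Ar, Finset.mem_filter, Finset.mem_univ, true_and]
  have hmemBr : ∀ q x, x ∈ Br q ↔ ∃ u₀, RB x u₀ q := fun q x => by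
    simp only [Br, Finset.mem_filter, Finset.mem_univ, true_and]
  -- (1) adjacency: `zz q` is a prefix record, `ww q` a suffix record, nothing strictly between is a record
  have hadj : ∀ q, q < n → zz q ∈ Ar q ∧ ww q ∈ Br q ∧ zz q < ww q ∧
      ∀ x : Fin L, zz q < x → x < ww q → x ∉ Ar q ∧ x ∉ Br q := by
    intro q hq
    have hd := hdom q hq
    refine ⟨(hmemAr q _).2 ⟨kk q, hcz q hq, fun k' z' hcz' hz' => ?_⟩, (hmemBr q _).2 ⟨uu q, fun u' w' hw' => ?_⟩,
      hzw q hq, fun x hzx hxw => ⟨fun h => ?_, fun h => ?_⟩⟩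
    · exact k_lt_of_dominant d v ε τ s₁ s₂ s₃ A₁ A₂ A₃ hinj hpres hw (hyz q hq) (hzw q hq)
        (Fin.lt_def.2 (by have := hyc q hq; omega)) (hz'.trans (hzw q hq)) hd
        (by rintro ⟨-, e⟩; exact absurd e (ne_of_gt hz'))
    · exact u_lt_of_dominant d v ε τ s₁ s₂ s₃ A₁ A₂ A₃ hinj hpres hw (hyz q hq) (hzw q hq) ((hzw q hq).trans hw') hd
        (by rintro ⟨-, e⟩; exact absurd e (ne_of_lt hw'))
    · obtain ⟨k₀, -, hk₀⟩ := (hmemAr q x).1 h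
      have h1 := hk₀ (kk q) (zz q) (hcz q hq) hzx
      have h2 := k_lt_of_dominant d v ε τ s₁ s₂ s₃ A₁ A₂ A₃ hinj hpres hw (hyz q hq) (hzw q hq)
        ((hyz q hq).trans hzx) hxw hd (k' := k₀) (by rintro ⟨-, e⟩; exact absurd e (ne_of_lt hzx))
      linarith
    · obtain ⟨u₀, hu₀⟩ := (hmemBr q x).1 h
      have h1 := hu₀ (uu q) (ww q) hxw
      have h2 := u_lt_of_dominant d v ε τ s₁ s₂ s₃ A₁ A₂ A₃ hinj hpres hw (hyz q hq) (hzw q hq) hzx hd (u' := u₀)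
        (by rintro ⟨-, e⟩; exact absurd e (ne_of_gt hxw))
      linarith
  -- (2) distinctness of the configurations
  have hinj' : ∀ q q', q < n → q' < n → kk q = kk q' → zz q = zz q' → ww q = ww q' → uu q = uu q' → q = q' := by
    intro q q' hq hq' e1 e2 e3 e4
    apply hconf'inj q q' hq hq'
    rw [← hmemω q hq, ← hmemω q' hq']
    exact Prod.ext e1 (Prod.ext e2 (Prod.ext e4 e3))
  -- (3) few flips: the record predicates are interval-shaped in time
  have hRA : ∀ x k₀, ∀ a b cc : ℕ, a < b → b < cc → cc < n → RA x k₀ a → RA x k₀ cc → RA x k₀ b := by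
    intro x k₀ a b cc hab hbc hc ha hc'
    refine ⟨ha.1, fun k' z' hcz' hz' => ?_⟩
    have h1 := ha.2 k' z' hcz' hz'
    have h2 := hc'.2 k' z' hcz' hz'
    have t1 := ht a b hab (hbc.trans hc)
    have t2 := ht b cc hbc hc
    rcases le_or_gt (s₂ k' z' - s₂ k₀ x) 0 with hs | hs
    · nlinarith
    · nlinarith
  have hRB : ∀ x u₀, ∀ a b cc : ℕ, a < b → b < cc → cc < n → RB x u₀ a → RB x u₀ cc → RB x u₀ b := by
    intro x u₀ a b cc hab hbc hc ha hc' u' w' hw'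
    have h1 := ha u' w' hw'
    have h2 := hc' u' w' hw'
    have t1 := ht a b hab (hbc.trans hc)
    have t2 := ht b cc hbc hc
    rcases le_or_gt (s₃ u' w' - s₃ u₀ x) 0 with hs | hs
    · nlinarith
    · nlinarith
  have hflipA : ∀ x : Fin L,
      ((Finset.range n).filter (fun q => q + 1 < n ∧ ¬ (x ∈ Ar q ↔ x ∈ Ar (q + 1)))).card ≤ 2 * N₂ := by
    intro x
    refine le_trans (Finset.card_le_card ?_) (card_flips_exists_le n N₂ (fun k₀ q => RA x k₀ q) (hRA x))
    intro q hq
    rw [Finset.mem_filter] at hq ⊢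
    rcases hq with ⟨hq1, hq2, hq3⟩
    exact ⟨hq1, hq2, by rwa [hmemAr, hmemAr] at hq3⟩
  have hflipB : ∀ x : Fin L,
      ((Finset.range n).filter (fun q => q + 1 < n ∧ ¬ (x ∈ Br q ↔ x ∈ Br (q + 1)))).card ≤ 2 * N₃ := by
    intro x
    refine le_trans (Finset.card_le_card ?_) (card_flips_exists_le n N₃ (fun u₀ q => RB x u₀ q) (hRB x))
    intro q hq
    rw [Finset.mem_filter] at hq ⊢
    rcases hq with ⟨hq1, hq2, hq3⟩
    exact ⟨hq1, hq2, by rwa [hmemBr, hmemBr] at hq3⟩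
  -- (4) state monotonicity along a fixed position
  have hmono₁ : ∀ q q', q < q' → q' < n → zz q = zz q' → kk q ≠ kk q' → s₂ (kk q) (zz q) < s₂ (kk q') (zz q) := by
    intro q q' hqq' hq' hzz hkk
    have hq : q < n := hqq'.trans hq'
    have h1 := k_lt_of_dominant d v ε τ s₁ s₂ s₃ A₁ A₂ A₃ hinj hpres hw (hyz q hq) (hzw q hq) (hyz q hq) (hzw q hq)
      (hdom q hq) (k' := kk q') (by rintro ⟨e, -⟩; exact hkk e)
    have h2 := k_lt_of_dominant d v ε τ s₁ s₂ s₃ A₁ A₂ A₃ hinj hpres hw (hyz q' hq') (hzw q' hq') (hyz q' hq')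
      (hzw q' hq') (hdom q' hq') (k' := kk q) (by rintro ⟨e, -⟩; exact hkk e.symm)
    rw [← hzz] at h2
    have t1 := ht q q' hqq' hq'
    nlinarith
  have hmono₂ : ∀ q q', q < q' → q' < n → ww q = ww q' → uu q ≠ uu q' → s₃ (uu q) (ww q) < s₃ (uu q') (ww q) := by
    intro q q' hqq' hq' hww huu
    have hq : q < n := hqq'.trans hq'
    have h1 := u_lt_of_dominant d v ε τ s₁ s₂ s₃ A₁ A₂ A₃ hinj hpres hw (hyz q hq) (hzw q hq) (hzw q hq) (hdom q hq)
      (u' := uu q') (by rintro ⟨e, -⟩; exact huu e)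
    have h2 := u_lt_of_dominant d v ε τ s₁ s₂ s₃ A₁ A₂ A₃ hinj hpres hw (hyz q' hq') (hzw q' hq') (hzw q' hq')
      (hdom q' hq') (u' := uu q) (by rintro ⟨e, -⟩; exact huu e.symm)
    rw [← hww] at h2
    have t1 := ht q q' hqq' hq'
    nlinarith
  exact card_le_of_adjacent_records n Ar Br zz ww kk uu (fun k₀ x => s₂ k₀ x) (fun x u₀ => s₃ u₀ x)
    hadj hinj' hflipA hflipB hmono₁ hmono₂

end Family

end Summit.ValiantsHypothesis.ValiantsHypothesis.Theorems.KPlusLogSqLaw.PureChain
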